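import Summits.CriticalPhenomena.Ising3DConformalLimit.Theorems.FKParityRobustnessIndependentStrandsJoinLimitDictionary
import HarnessLib

/-!
# Strategist s1 — typed statements behind STRATEGY-CENSUS.md (s1) §T12, §S12, §S15, §D10
(crux `IndependentStrandsJoin`, stmt-CriticalPhenomena-14625).  Definitions only; nothing is asserted.  rc0.
-/

noncomputable section

open Literature.Probability.LatticeModels
open Summit.CriticalPhenomena.Ising3DConformalLimit.Cruxes.IndependentStrandsJoin.PinchToTetra (yTetra)

namespace Summit.CriticalPhenomena.Ising3DConformalLimit.Cruxes.IndependentStrandsJoin.StrategyS1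

/-- The centred equilateral LATTICE triangle `P* = ((0,0,0),(3,3,0),(3,0,3),(2,1,1))` — planar (plane `a = b + c`), all three
pairing products equal to `6√3`, hence cross-ratios `u = v = 1`: Möbius-equivalent to the regular tetrahedron (§T12, G1). -/
def pStar : Fin 4 → Site 3 := ![![0, 0, 0], ![3, 3, 0], ![3, 0, 3], ![2, 1, 1]]

theorem pStar_injective : Function.Injective pStar := by
  unfold pStar; decide

/-- `P*` as a continuum configuration. -/
abbrev yPStar : Fin 4 → EuclideanSpace ℝ (Fin 3) := fun i => WithLp.toLp 2 fun k => ((pStar i k : ℤ) : ℝ)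

/-- **§D10 / §T12 — the Möbius half of the residual (PROVABLE NOW, M/L):** for a Möbius-covariant non-degenerate family the sign of
`U₄` at the centred equilateral triangle and at the regular tetrahedron agree (explicit Möbius map between the two equiproduct
configurations; all covariance factors are positive and common to `S₄` and to the Wick part). -/
def MoebiusPlanarTetra : Prop :=
  ∀ (Δ : ℝ) (S : CorrFamily 3), 0 < Δ → IsMoebiusCovariant Δ S → IsNondegenerateTwoPoint S →
    (limitConnectedFour S yPStar < 0 ↔ limitConnectedFour S yTetra < 0)

/-- **§T12 — `PlanarTransferM`**: under Möbius covariance of the posited limit, far merging of `U₄^crit` along the dilations of SOME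
injective lattice shape transfers to the PLANAR shape `L • P*` (equivalent, given `MoebiusPlanarTetra` and the landed dictionary, to r5's
`ShapeTransfer`; recorded as the sharper TARGET, not as an easier statement). -/
def PlanarTransferM : Prop :=
  (∃ c : ℝ, 0 < c ∧ ∃ a : Fin 4 → Site 3, Function.Injective a ∧ ∃ L₁ : ℕ, ∀ L : ℕ, L₁ ≤ L →
      criticalCorr 3 4 (fun i => (L : ℤ) • a i) -
          (criticalCorr 3 2 ![(L : ℤ) • a 0, (L : ℤ) • a 1] * criticalCorr 3 2 ![(L : ℤ) • a 2, (L : ℤ) • a 3] +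
            criticalCorr 3 2 ![(L : ℤ) • a 0, (L : ℤ) • a 2] * criticalCorr 3 2 ![(L : ℤ) • a 1, (L : ℤ) • a 3] +
            criticalCorr 3 2 ![(L : ℤ) • a 0, (L : ℤ) • a 3] * criticalCorr 3 2 ![(L : ℤ) • a 1, (L : ℤ) • a 2]) ≤
        -(c * (criticalCorr 3 2 ![(L : ℤ) • a 0, (L : ℤ) • a 1] * criticalCorr 3 2 ![(L : ℤ) • a 2, (L : ℤ) • a 3]))) →
    ∃ c : ℝ, 0 < c ∧ ∃ L₁ : ℕ, ∀ L : ℕ, L₁ ≤ L →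
      criticalCorr 3 4 (fun i => (L : ℤ) • pStar i) -
          (criticalCorr 3 2 ![(L : ℤ) • pStar 0, (L : ℤ) • pStar 1] * criticalCorr 3 2 ![(L : ℤ) • pStar 2, (L : ℤ) • pStar 3] +
            criticalCorr 3 2 ![(L : ℤ) • pStar 0, (L : ℤ) • pStar 2] * criticalCorr 3 2 ![(L : ℤ) • pStar 1, (L : ℤ) • pStar 3] +
            criticalCorr 3 2 ![(L : ℤ) • pStar 0, (L : ℤ) • pStar 3] * criticalCorr 3 2 ![(L : ℤ) • pStar 1, (L : ℤ) • pStar 2]) ≤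
        -(c * (criticalCorr 3 2 ![(L : ℤ) • pStar 0, (L : ℤ) • pStar 1] * criticalCorr 3 2 ![(L : ℤ) • pStar 2, (L : ℤ) • pStar 3]))

/-- **§S12 — strict Lebowitz EVERYWHERE in the limit** (implies TNV; the same propagation problem at every point). -/
def StrictLebowitzEverywhere : Prop :=
  ∀ (ρ : ℝ → ℝ) (S : CorrFamily 3), (∀ δ ∈ Set.Ioc (0:ℝ) 1, 0 < ρ δ) →
    HasPointwiseScalingLimit (criticalCorr 3) ρ S → IsNondegenerateTwoPoint S → HasNontrivialU4 S →
    ∀ x ∈ NonCoincident 3 4, limitConnectedFour S x < 0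

/-- The antiparallel kite `K(L; M) = (0, −M e₃, L e₂, M e₃)` (sourced pairs `{0, −Me₃}`, `{Le₂, Me₃}`); at `M/L = √3` its three pairing
products are equal (§T14). -/
def kite (L M : ℕ) : Fin 4 → Site 3 :=
  ![0, -((M : ℤ) • (Pi.single 2 1 : Site 3)), (L : ℤ) • (Pi.single 1 1 : Site 3), (M : ℤ) • (Pi.single 2 1 : Site 3)]

/-- Aizenman's merging ratio of the kite: `−U₄^crit(K)/(τ(0,−Me₃)·τ(Le₂,Me₃))` (`= 2·P[the two sourced double currents merge]`). -/
def kiteRatio (L M : ℕ) : ℝ :=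
  -(criticalCorr 3 4 (kite L M) -
      (criticalCorr 3 2 ![kite L M 0, kite L M 1] * criticalCorr 3 2 ![kite L M 2, kite L M 3] +
        criticalCorr 3 2 ![kite L M 0, kite L M 2] * criticalCorr 3 2 ![kite L M 1, kite L M 3] +
        criticalCorr 3 2 ![kite L M 0, kite L M 3] * criticalCorr 3 2 ![kite L M 1, kite L M 2])) /
    (criticalCorr 3 2 ![kite L M 0, kite L M 1] * criticalCorr 3 2 ![kite L M 2, kite L M 3])

/-- **§S15 — `KiteComparable`**: pulling the two far targets of the antiparallel kite inward by a bounded factor does not kill merging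
(a boundary-insensitivity property of SOURCED double currents; the four-point analogue of two-point doubling, item 6150; no tool; MC-killable). -/
def KiteComparable : Prop :=
  ∃ C : ℝ, 0 < C ∧ ∀ L : ℕ, 1 ≤ L → ∀ M M' : ℕ, L ≤ M → M ≤ M' → M' ≤ 4 * L → kiteRatio L M' ≤ C * kiteRatio L M

end Summit.CriticalPhenomena.Ising3DConformalLimit.Cruxes.IndependentStrandsJoin.StrategyS1
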